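import Summits.HodgeConjecture.HodgeConjecture.Theorems.CyclicUnitaryPowersPLPackageOfLocalMonodromyBound
import Summits.HodgeConjecture.HodgeConjecture.Theorems.CyclicUnitaryPowersK1OfLocalMonodromyGeometricGenus
import Literature.AlgebraicGeometry.HodgeTheory.SmoothHypersurfacesHomeomorphic
import Literature.AlgebraicGeometry.HodgeTheory.UnitaryReflectionGroupZariskiDenseHolds

/-!
# K1 `VeryGeneralDeckCommutatorsInHg` of route `CyclicUnitaryPowers` with the textbook binder PG RE-CUT to ONE number per prime:
# the geometric genus of the FERMAT surface of prime degree `p` (stmt-HodgeConjecture-19544)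

Prover seat `hodge-nonav-prover-Bx` (g10), cell `hodge-nonav`. Landed `--supports stmt-HodgeConjecture-19544 --as helper`; sorry-free, no
definition, no new named fact. CONDITIONAL results; nothing here says HC ∕ HC_AV is proved; rung F-H1 is not moved.

After registry v15 the crux K1-A hangs on `{F1‡, PG, CDK}` with PG = `Arapura2012_hypersurface_geometricGenus` (`h^{n,0}(X_F) = C(d−1, n+1)`
for ALL smooth hypersurfaces of ALL dimensions), consumed only at `n = 2`, `d = p` an odd prime. The tree now PROVES
(`Literature/…/SmoothHypersurfacesHomeomorphic`, this seat) that **for odd `d` the geometric genus `h^{2,0}` is the same for all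
smooth surfaces of degree `d` in `ℙ³`** (Ehresmann: they are homeomorphic; signed Hodge index theorem + homeomorphism invariance of
the signature + `b₂ ≡ d` odd), and (`SmoothSurfaceSecondBettiNumber`) `b₂ = d³ − 4d² + 6d − 2`. Hence PG's consumed clause follows
from ONE NUMBER PER PRIME — `h^{2,0}` of the Fermat surface `X²_p : Σ xᵢ^p = 0` — spelled here as the explicit hypothesis

  `hFermat : ∀ p, p.Prime → 5 ≤ p → ∀ hHD hX, (BettiUniverse.hodge hHD hX 2).hodgeNumber 2 0 = C(p−1, 3)`  (`X = fermatHypersurface 2 p`)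

(T. Shioda, Math. Ann. 245 (1979) §1 (1.7) / N. Aoki, T. Shioda (1983): the Hodge types of the character eigenlines of the Fermat
surface — `V(α) ⊂ H^{2,0}` iff `|α| = 1`, `C(p−1,3)` of them; equivalently adjunction `ω_X ≅ 𝒪_X(p−4)` for this one surface). No
`def` is introduced (D-0026): the hypothesis is inlined in each signature; the route owner may register it as the stub replacing PG.

* `finrank_piece_two_zero_cyclicCover_of_fermatGenus` — `h^{2,0}(X_F) = C(p−1, 3)` for every smooth cyclic cover `X_F : x₃^p = f`,
  `p ≥ 5` prime, from `hFermat` (p_g is constant among smooth surfaces of the odd degree `p`).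
* `finrank_eigenspace_inf_hodgePiece_prime_of_fermatGenus` — CT2's eigen-Hodge numbers at primes `p ≥ 5` from `hFermat` alone
  (`finrank_eigenspace_inf_hodgePiece_of_two_numbers` with `h^{2,0} ≤ dim S^{p−4}` from the above and `b₂` from
  `EisenbudHarris2016_surface_secondBettiNumber_holds`).
* `cyclicDeckHodge_of_fermatGenus` — the Deck clauses (iii)–(iv) (registered `stub_cyclicDeckHodge` shape) from `hFermat`.
* **`veryGeneralDeckCommutatorsInHg_of_localMonodromyBound_fermatGenus (hF1 : F1‡) (hFermat) (hCDK : CDK)`** and the leaf twin —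
  **K1-A ⟸ {F1‡, p_g(X²_p) = C(p−1,3) for primes p ≥ 5, CDK}**; also `…_of_localMonodromy_fermatGenus` on the F1† road.

## References

* [CarlsonToledo1999] J. A. Carlson, D. Toledo, Duke Math. J. 97 (1999), §2, §3, §5, §6, §7 Theorem 7.1.
* [CattaniDeligneKaplan1995] E. Cattani, P. Deligne, A. Kaplan, J. Amer. Math. Soc. 8 (1995), Thm. 1.1, Cor. 1.2.
* [Shioda1979HodgeFermat] T. Shioda, The Hodge conjecture for Fermat varieties, Math. Ann. 245 (1979), §1 (1.7).
* [Arapura2012] D. Arapura, Algebraic Geometry over the Complex Numbers, §17.3 (17.3.1).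
-/

noncomputable section


set_option linter.dupNamespace false

namespace Summit.HodgeConjecture.HodgeConjecture.Theorems.CyclicUnitaryPowersK1OfFermatGenus

open MvPolynomial CategoryTheory
open Literature.AlgebraicGeometry.Motives Literature.AlgebraicGeometry.HodgeTheory
open Literature.AlgebraicGeometry.HodgeTheory.BettiUniverse
open Literature.AlgebraicTopology.SingularHomology
open Literature.RingTheory.MvPolynomial (idealDegree)
open Summit.HodgeConjecture.HodgeConjecture.Theorems.CyclicUnitaryPowersK1OfPrintNumbers
open Summit.HodgeConjecture.HodgeConjecture.Theorems.CyclicUnitaryPowersPLPackageOfLocalMonodromyBound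
open Summit.HodgeConjecture.HodgeConjecture.Theorems.CyclicUnitaryPowersPLPackageOfLocalMonodromy
open Summit.HodgeConjecture.HodgeConjecture.Theorems.CyclicUnitaryPowersEigenHodgeNumbersOfTwoNumbers
open Summit.HodgeConjecture.HodgeConjecture.Theorems.CyclicUnitaryPowersDeckHodgeOfCarlsonToledo (hilbert_jacobianIdeal_eq_cube_getD)

variable {p : ℕ} {f : MvPolynomial (Fin 3) ℂ}

/-- **`h^{2,0}(X_F) = C(p−1, 3)` for every smooth cyclic cover `X_F : x₃^p = f(x₀,x₁,x₂)`, `p ≥ 5` prime, GRANTED the value at the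
Fermat surface `X²_p`**: `p` is odd, so `h^{2,0}` is the same for all smooth surfaces of degree `p`
(`hodgeNumber_two_zero_hypersurface_eq_of_odd`: Ehresmann + signed Hodge index + parity of `b₂`). CONDITIONAL on `hFermat`.
[cite: Shioda1979HodgeFermat, §1 (1.7)] [cite: Arapura2012, §17.3 (17.3.1)] -/
theorem finrank_piece_two_zero_cyclicCover_of_fermatGenus
    (hFermat : ∀ ⦃p : ℕ⦄, p.Prime → 5 ≤ p → ∀ (hHD : exists_isReal_hodgeModel)
      (hX : IsSmoothProjective 2 (fermatHypersurface 2 p)), (BettiUniverse.hodge hHD hX 2).hodgeNumber 2 0 = Nat.choose (p - 1) 3)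
    (hHD : exists_isReal_hodgeModel) (hp : p.Prime) (hp5 : 5 ≤ p) (hf : f.IsHomogeneous p) (hf0 : f ≠ 0)
    (hX : IsSmoothProjective 2 (SmoothHypersurface.hypersurface (cyclicCoverForm p f))) :
    Module.finrank ℂ ↥((BettiUniverse.hodge hHD hX 2).piece 2 0) = Nat.choose (p - 1) 3 := by
  have hF : (cyclicCoverForm p f).IsHomogeneous p := CyclicCoverFormNonsingular.isHomogeneous_cyclicCoverForm_of_isHomogeneous hf
  have hJ := CyclicCoverFormNonsingular.isNonsingularForm_cyclicCoverForm_of_isSmoothProjective (by omega) hf hf0 hX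
  have hodd : Odd p := hp.odd_of_ne_two (by omega)
  haveI : NeZero p := ⟨hp.ne_zero⟩
  have hXd : IsSmoothProjective 2 (fermatHypersurface 2 p) := isSmoothProjective_fermatHypersurface (by norm_num) hp.one_lt.le
  have h := hodgeNumber_two_zero_hypersurface_eq_of_odd hHD hodd hF hJ (isHomogeneous_fermatPolynomial 2 p)
    (SmoothHypersurface.isNonsingularForm_sum_X_pow (Nat.cast_ne_zero.mpr (NeZero.ne p))) hX hXd
  rw [hFermat hp hp5 hHD hXd] at h
  exact h

/-- **CT2's eigen-Hodge numbers at primes `p ≥ 5` from the Fermat genus alone**: for a smooth cyclic cover `X : x₃^p = f`,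
`dim (E_{ζ^i}(σ^*) ∩ H^{2−q,q}) = dim R(f)_{(q+1)p−3−i}` (`1 ≤ i < p`, `q ≤ 2`) — the tree's
`finrank_eigenspace_inf_hodgePiece_of_two_numbers` with `h^{2,0}(X) ≤ dim S^{p−4} = C(p−1,3)` from
`finrank_piece_two_zero_cyclicCover_of_fermatGenus` and `b₂(X) = p³ − 4p² + 6p − 2` from the THEOREM
`EisenbudHarris2016_surface_secondBettiNumber_holds`. CONDITIONAL on `hFermat`. [cite: CarlsonToledo1999, §5] [cite: Shioda1979HodgeFermat, §1 (1.7)] -/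
theorem finrank_eigenspace_inf_hodgePiece_prime_of_fermatGenus
    (hFermat : ∀ ⦃p : ℕ⦄, p.Prime → 5 ≤ p → ∀ (hHD : exists_isReal_hodgeModel)
      (hX : IsSmoothProjective 2 (fermatHypersurface 2 p)), (BettiUniverse.hodge hHD hX 2).hodgeNumber 2 0 = Nat.choose (p - 1) 3)
    (hHD : exists_isReal_hodgeModel) (hp : p.Prime) (hp5 : 5 ≤ p) (f : MvPolynomial (Fin 3) ℂ)
    (hf : f.IsHomogeneous p) (hf0 : f ≠ 0)
    (hX : IsSmoothProjective 2 (SmoothHypersurface.hypersurface (cyclicCoverForm p f)))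
    (ha : deckUnit p ∈ diagonalStabilizer (cyclicCoverForm p f))
    (i q : ℕ) (hi : 1 ≤ i) (hip : i < p) (hq : q ≤ 2) :
    Module.finrank ℂ ↥(Module.End.eigenspace
        ((BettiUniverse.pull (diagonalAut (cyclicCoverForm p f) ha) 2).baseChange ℂ)
        (Complex.exp (2 * (Real.pi : ℂ) * Complex.I / (p : ℂ)) ^ i) ⊓
      (BettiUniverse.hodge hHD hX 2).piece ((2 : ℤ) - q) q) =
    if (q + 1) * p < 3 + i then 0 else
      Module.finrank ℂ ↥(homogeneousSubmodule (Fin 3) ℂ ((q + 1) * p - 3 - i)) -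
        Module.finrank ℂ ↥(idealDegree (UniversalHypersurface.jacobianIdeal f) ((q + 1) * p - 3 - i)) := by
  have hF : (cyclicCoverForm p f).IsHomogeneous p := CyclicCoverFormNonsingular.isHomogeneous_cyclicCoverForm_of_isHomogeneous hf
  have hJ := CyclicCoverFormNonsingular.isNonsingularForm_cyclicCoverForm_of_isSmoothProjective (by omega) hf hf0 hX
  have hS : Module.finrank ℂ ↥(homogeneousSubmodule (Fin 4) ℂ (p - 4)) = Nat.choose (p - 1) 3 := by
    have h := finrank_homogeneousSubmodule_sub_eq_choose (n := 2) (d := p) (by omega)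
    rw [show p - (2 + 2) = p - 4 by omega] at h
    exact_mod_cast h
  have hpg : Module.finrank ℂ ↥((BettiUniverse.hodge hHD hX 2).piece 2 0) ≤
      Module.finrank ℂ ↥(homogeneousSubmodule (Fin 4) ℂ (p - 4)) := by
    rw [hS, finrank_piece_two_zero_cyclicCover_of_fermatGenus hFermat hHD hp hp5 hf hf0 hX]
  have hb2 := EisenbudHarris2016_surface_secondBettiNumber_holds (d := p) (by omega) (cyclicCoverForm p f) hF hJ hX
  exact finrank_eigenspace_inf_hodgePiece_of_two_numbers hHD hp hp5 hf hf0 hX ha hpg hb2 i q hi hip hq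

/- The registered `let`-prefix binds `pmul`; after `intro` it is only used through `ehn`. -/
set_option linter.unusedVariables false in
/-- **The Deck clauses (iii)–(iv) (registered `stub_cyclicDeckHodge` shape of earlier registries) from the Fermat genus**: (iii) is the
theorem `carlsonToledo1999_finrank_eigenspace_deck_one_holds`; (iv) at `ζ = e^{2πi/p}` is `finrank_eigenspace_inf_hodgePiece_prime_of_fermatGenus`
evaluated by Macaulay (`hilbert_jacobianIdeal_eq_cube_getD`). CONDITIONAL on `hFermat`.
[cite: CarlsonToledo1999, §2 (held text p0005) and §5 (held text p0011–p0012)] [cite: Shioda1979HodgeFermat, §1 (1.7)] -/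
theorem cyclicDeckHodge_of_fermatGenus
    (hFermat : ∀ ⦃p : ℕ⦄, p.Prime → 5 ≤ p → ∀ (hHD : exists_isReal_hodgeModel)
      (hX : IsSmoothProjective 2 (fermatHypersurface 2 p)), (BettiUniverse.hodge hHD hX 2).hodgeNumber 2 0 = Nat.choose (p - 1) 3) :
    open Literature.AlgebraicGeometry.Motives Literature.AlgebraicGeometry.HodgeTheory Literature.AlgebraicGeometry.HodgeTheory.BettiUniverse CategoryTheory.Limits in let pmul : List ℕ → List ℕ → List ℕ := fun a b => (List.range (a.length + b.length - 1)).map fun k => ((List.range (k + 1)).map fun i => a.getD i 0 * b.getD (k - i) 0).sum; let ehn : ℕ → ℕ → ℕ → ℕ := fun p j q => if (q + 1) * p < 3 + j then 0 else ((List.replicate 3 (List.replicate (p - 1) 1)).foldl pmul [1]).getD ((q + 1) * p - 3 - j) 0; ∀ ⦃p : ℕ⦄, p.Prime → 7 ≤ p → ∀ f : MvPolynomial (Fin 3) ℂ, f.IsHomogeneous p → f ≠ 0 → ∀ (hXF : IsSmoothProjective 2 (SmoothHypersurface.hypersurface (MvPolynomial.X (Fin.last 3) ^ p - MvPolynomial.rename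 Fin.castSucc f))) (ha : (fun i : Fin 4 => if i = Fin.last 3 then (Units.mk0 (Complex.exp (2 * (Real.pi : ℂ) * Complex.I / (p : ℂ))) (Complex.exp_ne_zero _)) else 1) ∈ diagonalStabilizer (MvPolynomial.X (Fin.last 3) ^ p - MvPolynomial.rename Fin.castSucc f)), Module.finrank ℚ ↥(Module.End.eigenspace (pull (diagonalAut (MvPolynomial.X (Fin.last 3) ^ p - MvPolynomial.rename Fin.castSucc f) ha) 2) 1) = 1 ∧ ∃ ζ : ℂ, IsPrimitiveRoot ζ p ∧ ∀ j q : ℕ, 1 ≤ j → j < p → q ≤ 2 → Module.finrank ℂ ↥(Module.End.eigenspace ((pull (diagonalAut (MvPolynomial.X (Fin.last 3) ^ p - MvPolynomial.rename Fin.castSucc f) ha) 2).baseChange ℂ) (ζ ^ j) ⊓ (hodge exists_isReal_hodgeModel_holds hXF 2).piece ((2 : ℤ) - q) q) = ehn p j q := by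
  intro pmul ehn p hp h7 f hf hf0 hXF ha
  have hp3 : 3 ≤ p := by omega
  refine ⟨carlsonToledo1999_finrank_eigenspace_deck_one_holds hp3 f hf hf0 hXF ha,
    Complex.exp (2 * (Real.pi : ℂ) * Complex.I / (p : ℂ)), Complex.isPrimitiveRoot_exp p (by omega),
    fun j q hj hjp hq ↦ ?_⟩
  refine (finrank_eigenspace_inf_hodgePiece_prime_of_fermatGenus hFermat exists_isReal_hodgeModel_holds hp (by omega)
    f hf hf0 hXF ha j q hj hjp hq).trans ?_
  simp only [ehn, pmul]
  split_ifs with hlt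
  · rfl
  · exact hilbert_jacobianIdeal_eq_cube_getD (by omega) hf hf0 hXF _

/-- **K1 `VeryGeneralDeckCommutatorsInHg` from {F1‡, the Fermat genus, CDK}** — F1‡ = `carlsonToledo1999_nodalMeridianLocalMonodromyBound`
(bound-form local monodromy at a one-nodal branch curve), the ONE number `h^{2,0}(X²_p) = C(p−1,3)` per prime `p ≥ 5`, and the
Cattani–Deligne–Kaplan cover; CT1, CT71 (`carlsonToledo1999_unitaryReflection_zariskiDense_holds`), B2 and the constancy of `p_g` in odd
degree being tree theorems. CONDITIONAL; nothing here says HC ∕ HC_AV is proved.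
[cite: CarlsonToledo1999, §2, §5, §6 (kdoublept), §7 Theorem 7.1] [cite: CattaniDeligneKaplan1995, Thm. 1.1 and Cor. 1.2]
[cite: Shioda1979HodgeFermat, §1 (1.7)] -/
theorem veryGeneralDeckCommutatorsInHg_of_localMonodromyBound_fermatGenus
    (hF1 : carlsonToledo1999_nodalMeridianLocalMonodromyBound)
    (hFermat : ∀ ⦃p : ℕ⦄, p.Prime → 5 ≤ p → ∀ (hHD : exists_isReal_hodgeModel)
      (hX : IsSmoothProjective 2 (fermatHypersurface 2 p)), (BettiUniverse.hodge hHD hX 2).hodgeNumber 2 0 = Nat.choose (p - 1) 3)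
    (hCDK : cmsp_nonHodgeGenericPoints_countable_algebraic_cover) :
    Summit.HodgeConjecture.HodgeConjecture.Theses.CyclicUnitaryPowers.VeryGeneralDeckCommutatorsInHg :=
  veryGeneralDeckCommutatorsInHg_of_deckHodge_prime
    (fun _ hp h7 => haveI : NeZero _ := ⟨hp.ne_zero⟩
      nonempty_carlsonToledoFamily_of_localMonodromyBound hF1 @EisenbudHarris2016_surface_secondBettiNumber_holds hp h7)
    (cyclicDeckHodge_of_fermatGenus hFermat) carlsonToledo1999_unitaryReflection_zariskiDense_holds @hCDK

/-- **The rung leaf `CyclicSurfacePowersHodge` (stmt-HodgeConjecture-19543) from the same three inputs** (via the fact-free step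
`cyclicSurfacePowersHodge_of_veryGeneralDeckCommutatorsInHg`). CONDITIONAL; rung F-H1 not moved.
[cite: CarlsonToledo1999, §2, §5, §6 (kdoublept), §7 Theorem 7.1] [cite: CattaniDeligneKaplan1995, Thm. 1.1 and Cor. 1.2] -/
theorem cyclicSurfacePowersHodge_of_localMonodromyBound_fermatGenus
    (hF1 : carlsonToledo1999_nodalMeridianLocalMonodromyBound)
    (hFermat : ∀ ⦃p : ℕ⦄, p.Prime → 5 ≤ p → ∀ (hHD : exists_isReal_hodgeModel)
      (hX : IsSmoothProjective 2 (fermatHypersurface 2 p)), (BettiUniverse.hodge hHD hX 2).hodgeNumber 2 0 = Nat.choose (p - 1) 3)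
    (hCDK : cmsp_nonHodgeGenericPoints_countable_algebraic_cover) :
    Summit.HodgeConjecture.HodgeConjecture.Theses.CyclicUnitaryPowers.CyclicSurfacePowersHodge :=
  CyclicUnitaryPowersCyclicSurfacePowersHodge.cyclicSurfacePowersHodge_of_veryGeneralDeckCommutatorsInHg
    (veryGeneralDeckCommutatorsInHg_of_localMonodromyBound_fermatGenus @hF1 hFermat @hCDK)

/-- **The F1† road, for the record**: K1 from F1† (`carlsonToledo1999_nodalMeridianLocalMonodromy`), the Fermat genus and CDK
(`nonempty_carlsonToledoFamily_of_localMonodromy`). CONDITIONAL. [cite: CarlsonToledo1999, §2, §5, §6, §7 Thm. 7.1]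
[cite: CattaniDeligneKaplan1995, Thm. 1.1 and Cor. 1.2] -/
theorem veryGeneralDeckCommutatorsInHg_of_localMonodromy_fermatGenus
    (hF1 : carlsonToledo1999_nodalMeridianLocalMonodromy)
    (hFermat : ∀ ⦃p : ℕ⦄, p.Prime → 5 ≤ p → ∀ (hHD : exists_isReal_hodgeModel)
      (hX : IsSmoothProjective 2 (fermatHypersurface 2 p)), (BettiUniverse.hodge hHD hX 2).hodgeNumber 2 0 = Nat.choose (p - 1) 3)
    (hCDK : cmsp_nonHodgeGenericPoints_countable_algebraic_cover) :
    Summit.HodgeConjecture.HodgeConjecture.Theses.CyclicUnitaryPowers.VeryGeneralDeckCommutatorsInHg :=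
  veryGeneralDeckCommutatorsInHg_of_deckHodge_prime
    (fun _ hp h7 => haveI : NeZero _ := ⟨hp.ne_zero⟩
      nonempty_carlsonToledoFamily_of_localMonodromy hF1 hp (by omega))
    (cyclicDeckHodge_of_fermatGenus hFermat) carlsonToledo1999_unitaryReflection_zariskiDense_holds @hCDK

end Summit.HodgeConjecture.HodgeConjecture.Theorems.CyclicUnitaryPowersK1OfFermatGenus

end
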